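import Mathlib
import Literature.Analysis.FluidPDE.TurbWave0
import Literature.Analysis.FluidPDE.TimeAverageMeasureBasic
import Literature.Analysis.FluidPDE.TimeAverageMeasureExistence
import HarnessLib

/-!
# The correlation function of a lag kernel under a generalized limit (stub F3)

Crux `LimitingAbsorption.FloorUpgrade` (stmt-AnomalousDissipation-15010), line `SketchIdeator1`,
stub `stub_corrPackage`. PURE TIME-AVERAGE ANALYSIS. `K τ t` is a jointly continuous "lag
kernel" (the correlation at lag `τ ≥ 0` observed from base time `t ≥ 0`), bounded by
`B e^{-βτ}`, with `K 0 t = M`, Cesàro-Lipschitz in the lag, positive semi-definite along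
shifted base times, and with a quadratic short-lag bound on the Cesàro means of `M - K τ`.
For a generalized (Banach) limit `Λ` the CORRELATION FUNCTION is
`C(τ) = Λ-avg_t K(|τ|, t) = Λ (T ↦ T⁻¹ ∫₀ᵀ K(|τ|, t) dt)`; we prove its six properties:
continuity (it is `|W|`-Lipschitz), evenness, `C 0 = M`, the exponential bound, positive
definiteness in the finite-sum sense, and the short-lag bound `C 0 - C τ ≤ δ|τ| + ατ²`.

Route: linearity of `Λ` and of the Cesàro means, `|Λ g| ≤ c` from an eventual bound
`|g| ≤ c`, positivity of `Λ` on eventually bounded functions, and SHIFT INVARIANCE of the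
generalized long-time average of a bounded continuous function
(`CorrPackage.longTimeAvg_comp_add_right`: `T⁻¹(∫ₛ^{T+s} φ - ∫₀ᵀ φ) = T⁻¹(∫_T^{T+s} φ - ∫₀ˢ φ) → 0`),
which turns the shifted base times `t + min(τᵢ, τⱼ)` of the positive semi-definiteness
hypothesis into unshifted ones.
-/

set_option linter.dupNamespace false

noncomputable section

open MeasureTheory Set Filter Topology
open scoped BigOperators

namespace Summit.AnomalousDissipation.AnomalousDissipation.Theorems.FloorUpgradeLine

namespace CorrPackage

open Literature.Analysis.FluidPDE

variable (Λ : GeneralizedLimit) {K : ℝ → ℝ → ℝ} {M B β δ α W T₀ : ℝ}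

/-! ### Generalized long-time averages: finite sums, shifts, positivity on `[0, ∞)` -/

/-- **Linearity over finite sums** of the generalized long-time average, for functions that are
interval integrable on every `[0, T]`, `T > 0` (the Cesàro means are additive there and `Λ` is
linear and only sees the germ at `+∞`). [folklore] -/
theorem longTimeAvg_finset_sum {ι : Type*} (s : Finset ι) {F : ι → ℝ → ℝ}
    (hF : ∀ k ∈ s, ∀ T, 0 < T → IntervalIntegrable (F k) volume 0 T) :
    Λ.longTimeAvg (fun t => ∑ k ∈ s, F k t) = ∑ k ∈ s, Λ.longTimeAvg (F k) := by
  unfold GeneralizedLimit.longTimeAvg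
  have h : timeMean (fun t => ∑ k ∈ s, F k t) =ᶠ[atTop] ∑ k ∈ s, timeMean (F k) := by
    filter_upwards [eventually_gt_atTop 0] with T hT
    simp only [timeMean, Finset.sum_apply]
    rw [intervalIntegral.integral_finsetSum (fun k hk => hF k hk T hT), Finset.mul_sum]
  rw [Λ.apply_eq_of_eventuallyEq h, map_sum]

/-- **Shift invariance** of the generalized long-time average: for a continuous `φ` bounded on
`[0, ∞)` and `s ≥ 0`, `Λ-avg φ(· + s) = Λ-avg φ`. Indeed
`T⁻¹ ∫₀ᵀ φ(t + s) dt - T⁻¹ ∫₀ᵀ φ = T⁻¹ (∫_T^{T+s} φ - ∫₀ˢ φ)` is `O(s/T) → 0`, so `Λ` of the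
difference of the Cesàro means vanishes (`Λ = lim` on convergent functions). [folklore] -/
theorem longTimeAvg_comp_add_right {φ : ℝ → ℝ} (hφ : Continuous φ) {s C : ℝ} (hs : 0 ≤ s)
    (hC : ∀ t, 0 ≤ t → |φ t| ≤ C) :
    Λ.longTimeAvg (fun t => φ (t + s)) = Λ.longTimeAvg φ := by
  unfold GeneralizedLimit.longTimeAvg
  have h0 : Λ (timeMean (fun t => φ (t + s)) - timeMean φ) = 0 := by
    refine Λ.apply_eq_of_tendsto ?_
    have hup : Tendsto (fun T : ℝ => 2 * C * s * T⁻¹) atTop (𝓝 0) := by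
      simpa using tendsto_inv_atTop_zero.const_mul (2 * C * s)
    refine squeeze_zero_norm' ?_ hup
    filter_upwards [eventually_gt_atTop 0] with T hT
    rw [Real.norm_eq_abs, Pi.sub_apply]
    simp only [timeMean]
    rw [intervalIntegral.integral_comp_add_right (fun t => φ t) s, zero_add, ← mul_sub,
      intervalIntegral.integral_interval_sub_interval_comm' (hφ.intervalIntegrable _ _)
        (hφ.intervalIntegrable _ _) (hφ.intervalIntegrable _ _)]
    have h1 : ‖∫ x in T..T + s, φ x‖ ≤ C * |T + s - T| :=
      intervalIntegral.norm_integral_le_of_norm_le_const fun t ht => by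
        rw [uIoc_of_le (by linarith)] at ht
        rw [Real.norm_eq_abs]
        exact hC t (by linarith [ht.1])
    have h2 : ‖∫ x in (0 : ℝ)..s, φ x‖ ≤ C * |s - 0| :=
      intervalIntegral.norm_integral_le_of_norm_le_const fun t ht => by
        rw [uIoc_of_le hs] at ht
        rw [Real.norm_eq_abs]
        exact hC t ht.1.le
    rw [add_sub_cancel_left, abs_of_nonneg hs, Real.norm_eq_abs] at h1
    rw [sub_zero, abs_of_nonneg hs, Real.norm_eq_abs] at h2
    rw [abs_mul, abs_inv, abs_of_pos hT]
    calc T⁻¹ * |(∫ x in T..T + s, φ x) - ∫ x in (0 : ℝ)..s, φ x|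
        ≤ T⁻¹ * (C * s + C * s) := by
          gcongr
          exact (abs_sub _ _).trans (add_le_add h1 h2)
      _ = 2 * C * s * T⁻¹ := by ring
  rw [map_sub] at h0
  linarith

/-- **Positivity** of the generalized long-time average for a function that is nonnegative on
`[0, ∞)` and bounded on `(0, ∞)` (only `t ≥ 0` enters the Cesàro means). [folklore] -/
theorem longTimeAvg_nonneg_of_nonneg {g : ℝ → ℝ} (h0 : ∀ t, 0 ≤ t → 0 ≤ g t) {C : ℝ}
    (hC : ∀ t, 0 < t → |g t| ≤ C) : 0 ≤ Λ.longTimeAvg g := by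
  unfold GeneralizedLimit.longTimeAvg
  refine Λ.apply_nonneg (isBoundedUnder_le_timeMean hC) ?_
  filter_upwards [eventually_gt_atTop 0] with T hT
  unfold timeMean
  exact mul_nonneg (inv_nonneg.2 hT.le)
    (intervalIntegral.integral_nonneg hT.le fun t ht => h0 t ht.1)

/-! ### Slices of a jointly continuous lag kernel -/

/-- A shifted time slice `t ↦ K τ (t + a)` of a jointly continuous kernel is continuous. [folklore] -/
theorem continuous_slice (hcont : Continuous (Function.uncurry K)) (τ a : ℝ) :
    Continuous fun t => K τ (t + a) :=
  hcont.comp (continuous_const.prodMk (continuous_id.add continuous_const))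

/-- A time slice `K τ` of a jointly continuous kernel is continuous. [folklore] -/
theorem continuous_slice₀ (hcont : Continuous (Function.uncurry K)) (τ : ℝ) :
    Continuous (K τ) :=
  hcont.comp (continuous_const.prodMk continuous_id)

/-- **Linearity on a weighted double sum of shifted slices**:
`Λ-avg (t ↦ ∑ᵢⱼ cᵢ cⱼ K dᵢⱼ (t + mᵢⱼ)) = ∑ᵢⱼ cᵢ cⱼ Λ-avg (t ↦ K dᵢⱼ (t + mᵢⱼ))` (each summand is
continuous, hence locally integrable). [folklore] -/
theorem longTimeAvg_double_sum (hcont : Continuous (Function.uncurry K)) (n : ℕ)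
    (c : Fin n → ℝ) (d m : Fin n → Fin n → ℝ) :
    Λ.longTimeAvg (fun t => ∑ i, ∑ j, c i * c j * K (d i j) (t + m i j)) =
      ∑ i, ∑ j, c i * c j * Λ.longTimeAvg (fun t => K (d i j) (t + m i j)) := by
  have h1 : ∀ i, Λ.longTimeAvg (fun t => ∑ j, c i * c j * K (d i j) (t + m i j)) =
      ∑ j, c i * c j * Λ.longTimeAvg (fun t => K (d i j) (t + m i j)) := fun i => by
    have h := longTimeAvg_finset_sum Λ Finset.univ
      (F := fun j t => c i * c j * K (d i j) (t + m i j))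
      (fun j _ T _ =>
        (continuous_const.mul (continuous_slice hcont (d i j) (m i j))).intervalIntegrable 0 T)
    refine h.trans (Finset.sum_congr rfl fun j _ => ?_)
    exact Λ.longTimeAvg_const_mul (c i * c j) _
  have h := longTimeAvg_finset_sum Λ Finset.univ
    (F := fun i t => ∑ j, c i * c j * K (d i j) (t + m i j))
    (fun i _ T _ => (continuous_finsetSum _ fun j _ =>
      continuous_const.mul (continuous_slice hcont (d i j) (m i j))).intervalIntegrable 0 T)
  exact h.trans (Finset.sum_congr rfl fun i _ => h1 i)

/-! ### The six properties of the correlation function `C τ = Λ-avg K |τ|` -/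

/-- **`C 0 = M`**: the slice `K 0` equals `M` on `[0, ∞)`, so its Cesàro means are `M` for
`T > 0` and `Λ = lim` on constants. [folklore] -/
theorem corr_zero (hK0 : ∀ t, 0 ≤ t → K 0 t = M) : Λ.longTimeAvg (K |0|) = M := by
  rw [abs_zero]
  unfold GeneralizedLimit.longTimeAvg
  have h : timeMean (K 0) =ᶠ[atTop] fun _ => M := by
    filter_upwards [eventually_gt_atTop 0] with T hT
    rw [timeMean_congr (h := fun _ => M) (fun t ht => hK0 t ht.le) hT.le]
    simp only [timeMean, intervalIntegral.integral_const, sub_zero, smul_eq_mul]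
    field_simp
  rw [Λ.apply_eq_of_eventuallyEq h, Λ.apply_const]

/-- **Exponential bound**: `|C τ| ≤ B e^{-β|τ|}`, from the pointwise bound on the slice `K |τ|`
on `(0, ∞)` and `|Λ g| ≤ c` for eventually `|g| ≤ c`. [folklore] -/
theorem abs_corr_le (hbd : ∀ τ t, 0 ≤ τ → 0 ≤ t → |K τ t| ≤ B * Real.exp (-(β * τ))) (τ : ℝ) :
    |Λ.longTimeAvg (K |τ|)| ≤ B * Real.exp (-(β * |τ|)) :=
  Λ.abs_longTimeAvg_le fun t ht => hbd |τ| t (abs_nonneg τ) ht.le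

/-- **Lipschitz bound**: `|C τ' - C τ| ≤ |W| · |τ' - τ|`. Order the two lags `|τ| ≤ |τ'|`; for
`T ≥ max T₀ |τ'|` the Cesàro means differ by at most `W (|τ'| - |τ|) ≤ |W| · |τ' - τ|`, and
`Λ` of the (eventually bounded) difference obeys the same bound by linearity. [folklore] -/
theorem abs_corr_sub_corr_le (hlip : ∀ T, T₀ ≤ T → ∀ τ τ', 0 ≤ τ → τ ≤ τ' → τ' ≤ T →
      |timeMean (K τ') T - timeMean (K τ) T| ≤ W * (τ' - τ)) (τ τ' : ℝ) :
    |Λ.longTimeAvg (K |τ'|) - Λ.longTimeAvg (K |τ|)| ≤ |W| * |τ' - τ| := by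
  suffices H : ∀ a b : ℝ, |a| ≤ |b| →
      |Λ.longTimeAvg (K |b|) - Λ.longTimeAvg (K |a|)| ≤ |W| * |b - a| by
    rcases le_total |τ| |τ'| with h | h
    · exact H τ τ' h
    · rw [abs_sub_comm (Λ.longTimeAvg (K |τ'|)), abs_sub_comm τ' τ]
      exact H τ' τ h
  intro a b hab
  unfold GeneralizedLimit.longTimeAvg
  rw [← map_sub]
  refine Λ.abs_apply_le ?_
  filter_upwards [eventually_ge_atTop T₀, eventually_ge_atTop |b|] with T hT hTb
  rw [Pi.sub_apply]
  calc |timeMean (K |b|) T - timeMean (K |a|) T| ≤ W * (|b| - |a|) :=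
        hlip T hT |a| |b| (abs_nonneg a) hab hTb
    _ ≤ |W| * |(|b| - |a|)| := by
        rw [abs_of_nonneg (sub_nonneg.2 hab)]
        exact mul_le_mul_of_nonneg_right (le_abs_self W) (sub_nonneg.2 hab)
    _ ≤ |W| * |b - a| := mul_le_mul_of_nonneg_left (abs_abs_sub_abs_le b a) (abs_nonneg W)

/-- **Continuity** of the correlation function: it is `|W|`-Lipschitz
(`abs_corr_sub_corr_le`). [folklore] -/
theorem continuous_corr (hlip : ∀ T, T₀ ≤ T → ∀ τ τ', 0 ≤ τ → τ ≤ τ' → τ' ≤ T →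
      |timeMean (K τ') T - timeMean (K τ) T| ≤ W * (τ' - τ)) :
    Continuous (fun τ => Λ.longTimeAvg (K |τ|)) := by
  refine (LipschitzWith.of_dist_le' (K := |W|) fun x y => ?_).continuous
  rw [Real.dist_eq, Real.dist_eq]
  exact abs_corr_sub_corr_le Λ hlip y x

/-- **Positive definiteness** in the finite-sum sense: `∑ᵢⱼ cᵢ cⱼ C(τᵢ - τⱼ) ≥ 0`. Shift the lags
to `σᵢ = τᵢ + ∑ⱼ |τⱼ| ≥ 0` (differences unchanged); the hypothesis gives
`g(t) = ∑ᵢⱼ cᵢ cⱼ K |σᵢ - σⱼ| (t + σᵢ ∧ σⱼ) ≥ 0` for `t ≥ 0`, a continuous function bounded on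
`[0, ∞)`, so `Λ-avg g ≥ 0`; by linearity and shift invariance
`Λ-avg g = ∑ᵢⱼ cᵢ cⱼ Λ-avg K |τᵢ - τⱼ|`. [folklore] -/
theorem corr_psd (hcont : Continuous (Function.uncurry K))
    (hbd : ∀ τ t, 0 ≤ τ → 0 ≤ t → |K τ t| ≤ B * Real.exp (-(β * τ)))
    (hpsd : ∀ (n : ℕ) (τs c : Fin n → ℝ) (t : ℝ), (∀ i, 0 ≤ τs i) → 0 ≤ t →
      0 ≤ ∑ i, ∑ j, c i * c j * K (|τs i - τs j|) (t + min (τs i) (τs j)))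
    (n : ℕ) (τs c : Fin n → ℝ) :
    0 ≤ ∑ i, ∑ j, c i * c j * Λ.longTimeAvg (K |τs i - τs j|) := by
  -- shift the lags into `[0, ∞)`
  obtain ⟨σ, hσ0, hdiff⟩ : ∃ σ : Fin n → ℝ, (∀ i, 0 ≤ σ i) ∧ ∀ i j, σ i - σ j = τs i - τs j := by
    refine ⟨fun i => τs i + ∑ j, |τs j|, fun i => ?_, fun i j => by ring⟩
    have h1 : |τs i| ≤ ∑ j, |τs j| :=
      Finset.single_le_sum (f := fun j => |τs j|) (fun j _ => abs_nonneg (τs j)) (Finset.mem_univ i)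
    have h2 := neg_abs_le (τs i)
    linarith
  -- the nonnegative bounded continuous function `g`
  have hg0 : ∀ t, 0 ≤ t → 0 ≤ ∑ i, ∑ j, c i * c j * K |τs i - τs j| (t + min (σ i) (σ j)) := by
    intro t ht
    have h := hpsd n σ c t hσ0 ht
    simpa only [hdiff] using h
  have hgC : ∀ t, 0 < t → |∑ i, ∑ j, c i * c j * K |τs i - τs j| (t + min (σ i) (σ j))| ≤
      ∑ i, ∑ j, |c i * c j| * (B * Real.exp (-(β * |τs i - τs j|))) := by
    intro t ht
    refine (Finset.abs_sum_le_sum_abs _ _).trans (Finset.sum_le_sum fun i _ => ?_)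
    refine (Finset.abs_sum_le_sum_abs _ _).trans (Finset.sum_le_sum fun j _ => ?_)
    rw [abs_mul]
    exact mul_le_mul_of_nonneg_left
      (hbd _ _ (abs_nonneg _) (by linarith [le_min (hσ0 i) (hσ0 j)])) (abs_nonneg _)
  calc (0 : ℝ) ≤ Λ.longTimeAvg (fun t => ∑ i, ∑ j, c i * c j * K |τs i - τs j| (t + min (σ i) (σ j))) :=
        longTimeAvg_nonneg_of_nonneg Λ hg0 hgC
    _ = ∑ i, ∑ j, c i * c j * Λ.longTimeAvg (fun t => K |τs i - τs j| (t + min (σ i) (σ j))) :=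
        longTimeAvg_double_sum Λ hcont n c (fun i j => |τs i - τs j|) (fun i j => min (σ i) (σ j))
    _ = ∑ i, ∑ j, c i * c j * Λ.longTimeAvg (K |τs i - τs j|) := by
        refine Finset.sum_congr rfl fun i _ => Finset.sum_congr rfl fun j _ => ?_
        rw [longTimeAvg_comp_add_right Λ (continuous_slice₀ hcont |τs i - τs j|)
          (le_min (hσ0 i) (hσ0 j)) (fun t ht => hbd _ t (abs_nonneg _) ht)]

/-- **Short-lag bound**: `C 0 - C τ ≤ δ|τ| + ατ²`. By linearity and `K 0 = M` on `[0, ∞)`,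
`C 0 - C τ = Λ (T ↦ T⁻¹ ∫₀ᵀ (M - K |τ| t) dt)`, an eventually bounded function which is
eventually `≤ δ|τ| + α|τ|² + ε` for every `ε > 0`; `Λ ≤ limsup`. [folklore] -/
theorem corr_zero_sub_corr_le (hcont : Continuous (Function.uncurry K))
    (hK0 : ∀ t, 0 ≤ t → K 0 t = M)
    (hbd : ∀ τ t, 0 ≤ τ → 0 ≤ t → |K τ t| ≤ B * Real.exp (-(β * τ)))
    (hquad : ∀ τ, 0 ≤ τ → ∀ ε, 0 < ε → ∀ᶠ T in Filter.atTop,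
      timeMean (fun t => M - K τ t) T ≤ δ * τ + α * τ ^ 2 + ε) (τ : ℝ) :
    Λ.longTimeAvg (K |0|) - Λ.longTimeAvg (K |τ|) ≤ δ * |τ| + α * τ ^ 2 := by
  have hid : Λ.longTimeAvg (K |0|) - Λ.longTimeAvg (K |τ|) =
      Λ (timeMean fun t => M - K |τ| t) := by
    unfold GeneralizedLimit.longTimeAvg
    rw [← map_sub, abs_zero]
    refine Λ.apply_eq_of_eventuallyEq ?_
    filter_upwards [eventually_gt_atTop 0] with T hT
    rw [Pi.sub_apply, timeMean_congr (g := fun t => M - K |τ| t) (h := fun t => K 0 t - K |τ| t)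
      (fun t ht => by rw [hK0 t ht.le]) hT.le]
    simp only [timeMean]
    rw [intervalIntegral.integral_sub ((continuous_slice₀ hcont 0).intervalIntegrable _ _)
      ((continuous_slice₀ hcont |τ|).intervalIntegrable _ _), mul_sub]
  rw [hid]
  refine le_of_forall_pos_le_add fun ε hε => ?_
  refine Λ.apply_le_of_eventually_le
    (isBoundedUnder_ge_timeMean (C := |M| + B * Real.exp (-(β * |τ|))) fun t ht => ?_) ?_
  · calc |M - K |τ| t| ≤ |M| + |K |τ| t| := abs_sub _ _
      _ ≤ |M| + B * Real.exp (-(β * |τ|)) := by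
          gcongr
          exact hbd |τ| t (abs_nonneg τ) ht.le
  · have h := hquad |τ| (abs_nonneg τ) ε hε
    simpa only [sq_abs] using h

end CorrPackage

/-- **F3.** The correlation function of a lag kernel under a generalized limit. Let `K τ t` be
jointly continuous with `K 0 t = M` (`t ≥ 0`), `|K τ t| ≤ B e^{-βτ}` (`τ, t ≥ 0`), Cesàro-Lipschitz
in the lag (`|T⁻¹∫₀ᵀ K τ' - T⁻¹∫₀ᵀ K τ| ≤ W (τ' - τ)` for `0 ≤ τ ≤ τ' ≤ T`, `T ≥ T₀`), positive
semi-definite along shifted base times (`∑ᵢⱼ cᵢcⱼ K |τᵢ - τⱼ| (t + τᵢ ∧ τⱼ) ≥ 0`), and with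
Cesàro means of `M - K τ` eventually `≤ δτ + ατ² + ε`. Then `C(τ) = Λ-avg_t K(|τ|, t)` is
continuous, even, `C 0 = M`, `|C τ| ≤ B e^{-β|τ|}`, positive-definite in the finite-sum sense, and
`C 0 - C τ ≤ δ|τ| + ατ²` (linearity and positivity of `Λ`, `liminf ≤ Λ ≤ limsup`, and shift
invariance of generalized long-time averages of bounded continuous functions). [folklore] -/
theorem stub_corrPackage (K : ℝ → ℝ → ℝ) (M B β δ α W T₀ : ℝ)
    (Λ : Literature.Analysis.FluidPDE.GeneralizedLimit)
    (_hM : 0 < M) (_hβ : 0 < β) (_hδ : 0 ≤ δ) (_hα : 0 ≤ α)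
    (hcont : Continuous (Function.uncurry K))
    (hK0 : ∀ t, 0 ≤ t → K 0 t = M)
    (hbd : ∀ τ t, 0 ≤ τ → 0 ≤ t → |K τ t| ≤ B * Real.exp (-(β * τ)))
    (hlip : ∀ T, T₀ ≤ T → ∀ τ τ', 0 ≤ τ → τ ≤ τ' → τ' ≤ T →
      |Literature.Analysis.FluidPDE.timeMean (K τ') T -
        Literature.Analysis.FluidPDE.timeMean (K τ) T| ≤ W * (τ' - τ))
    (hpsd : ∀ (n : ℕ) (τs c : Fin n → ℝ) (t : ℝ), (∀ i, 0 ≤ τs i) → 0 ≤ t →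
      0 ≤ ∑ i, ∑ j, c i * c j * K (|τs i - τs j|) (t + min (τs i) (τs j)))
    (hquad : ∀ τ, 0 ≤ τ → ∀ ε, 0 < ε → ∀ᶠ T in Filter.atTop,
      Literature.Analysis.FluidPDE.timeMean (fun t => M - K τ t) T ≤ δ * τ + α * τ ^ 2 + ε) :
    Continuous (fun τ => Λ.longTimeAvg (K |τ|)) ∧
    (∀ τ, (fun τ => Λ.longTimeAvg (K |τ|)) (-τ) = (fun τ => Λ.longTimeAvg (K |τ|)) τ) ∧
    (fun τ => Λ.longTimeAvg (K |τ|)) 0 = M ∧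
    (∀ τ, |(fun τ => Λ.longTimeAvg (K |τ|)) τ| ≤ B * Real.exp (-(β * |τ|))) ∧
    (∀ (n : ℕ) (τs c : Fin n → ℝ),
      0 ≤ ∑ i, ∑ j, c i * c j * (fun τ => Λ.longTimeAvg (K |τ|)) (τs i - τs j)) ∧
    (∀ τ, (fun τ => Λ.longTimeAvg (K |τ|)) 0 - (fun τ => Λ.longTimeAvg (K |τ|)) τ ≤
      δ * |τ| + α * τ ^ 2) := by
  refine ⟨CorrPackage.continuous_corr Λ hlip, fun τ => ?_, CorrPackage.corr_zero Λ hK0,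
    fun τ => CorrPackage.abs_corr_le Λ hbd τ,
    fun n τs c => CorrPackage.corr_psd Λ hcont hbd hpsd n τs c,
    fun τ => CorrPackage.corr_zero_sub_corr_le Λ hcont hK0 hbd hquad τ⟩
  simp only [abs_neg]

end Summit.AnomalousDissipation.AnomalousDissipation.Theorems.FloorUpgradeLine

end
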